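import Literature.MathematicalPhysics.QuantumManyBody.PeriodicBoseGasUpperBoundProofs
import Literature.MathematicalPhysics.QuantumManyBody.HardCoreScatteringLength
import Literature.MathematicalPhysics.QuantumManyBody.LatticePowerSums
import Mathlib.Analysis.Real.Pi.Bounds
import HarnessLib

/-!
# Uniform kinetic budget of periodic minimisers and the infrared lattice bookkeeping in `d = 3`

Topic `Literature/MathematicalPhysics/QuantumManyBody`, namespace `BoseGas`. Quantitative inputs of
the infrared ("Lévy weight × structure factor") bookkeeping for Bose–Einstein condensation of
dilute periodic minimisers [Stringari1995, §2], [PitaevskiiStringari1991], in the form consumed by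
the glue step of the chain (kinetic short-distance coherence + a structure-factor floor + a Lévy
bound ⇒ macroscopic zero mode):

* `periodizedPotential_mono_of_le`, `periodicInteraction_mono_of_le`, `periodicEnergy_mono_of_le`,
  `periodicGroundStateEnergy_mono_of_le` — monotonicity of the periodic energy in the potential;
  `le_hardCorePotential_two_mul` — a potential of range `≤ R` lies below the hard core of radius `2R`;
* `kinetic_le_of_minimiser_uniform` — **uniform kinetic budget**: for every `R > 0` there is
  `ρ₁ > 0` such that for `0 < ρ < ρ₁` and all large `N`, every minimiser of the periodic energy of
  ANY potential vanishing beyond `R` on the torus of side `(N/ρ)^{1/3}` has kinetic energy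
  `T ≤ 16πRρN` — from `T ≤ E₀^per(v) ≤ E₀^per(hard core 2R) ≤ 4πρ₁a(1 + Ca/b)N`, `a = 2R`
  ([LSSY2005, Thm. 2.2 (2.14)], proved in the tree as `LSSY2005_upperBound_periodic_holds`, and
  `scatteringLength_hardCorePotential`);
* `sum_inv_norm_sq_latticeVec_le`, `weighted_infrared_sum_le` — the **infrared lattice sum in
  `d = 3`**: `∑_{0<|m|≤M} |m|⁻² ≤ 96M` (shell counting of `LatticePowerSums.lean`) and its weighted
  form `∑_{m∈s} w_m|k_m|⁻² ≤ A₂·96κL³/(2π)³ + κ⁻²B` for weights `w ≤ A₂` with partial sums `≤ B`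
  (this is where the dimension enters: the sum of `|k|⁻²` over a ball grows linearly);
* `levy_le_of_floor` (`min(½, K/(16C_Fρ)) ≤ S`, `NνS ≤ C_I` ⇒ `ν ≤ (C_I/N)(2 + 16C_Fρ/K)`) and
  `zero_mode_error_budget` (the three error terms collected into `A²·s·C_I(16 + 136C_F)/d₀³`).

## References

* E. H. Lieb, R. Seiringer, J. P. Solovej, J. Yngvason, *The Mathematics of the Bose Gas and its
  Condensation*, Birkhäuser 2005, Thm. 2.2 (2.14), Ch. 2 after (2.1) (hard core). [`LSSY2005`]
* S. Stringari, in *Bose–Einstein Condensation*, CUP 1995, §2.2. [`Stringari1995`]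
* L. Pitaevskii, S. Stringari, J. Low Temp. Phys. 85 (1991) 377. [`PitaevskiiStringari1991`]
* G. Basti, S. Cenatiempo, B. Schlein, Forum Math. Sigma 9 (2021) e74, §5. [`BastiCenatiempoSchlein2021`]
-/

noncomputable section

open MeasureTheory Filter Set
open scoped ENNReal NNReal Topology

namespace Literature.MathematicalPhysics.QuantumManyBody.BoseGas

/-! ### Monotonicity of the periodic energy in the potential -/

/-- `v ↦ v^per` is monotone. [folklore] -/
theorem periodizedPotential_mono_of_le {w₁ w₂ : ℝ → ℝ≥0∞} (hw : ∀ r, w₁ r ≤ w₂ r) (L : ℝ)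
    (x : Space) : periodizedPotential w₁ L x ≤ periodizedPotential w₂ L x :=
  ENNReal.tsum_le_tsum fun _ => hw _

/-- `v ↦ ∑_{i<j} v^per(xᵢ - xⱼ)` is monotone. [folklore] -/
theorem periodicInteraction_mono_of_le {N : ℕ} {w₁ w₂ : ℝ → ℝ≥0∞} (hw : ∀ r, w₁ r ≤ w₂ r) (L : ℝ)
    (X : Config N) : periodicInteraction w₁ L X ≤ periodicInteraction w₂ L X := by
  unfold periodicInteraction
  exact Finset.sum_le_sum fun i _ => Finset.sum_le_sum fun j _ => periodizedPotential_mono_of_le hw L _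

/-- `v ↦ ⟨Ψ, H_v Ψ⟩` is monotone. [folklore] -/
theorem periodicEnergy_mono_of_le {N : ℕ} {L : ℝ} {w₁ w₂ : ℝ → ℝ≥0∞} (hw : ∀ r, w₁ r ≤ w₂ r)
    (Ψ : PeriodicTrialState N L) : periodicEnergy w₁ Ψ ≤ periodicEnergy w₂ Ψ := by
  unfold periodicEnergy
  exact lintegral_mono fun X =>
    add_le_add le_rfl (mul_le_mul' (periodicInteraction_mono_of_le hw L X) le_rfl)

/-- `v ↦ E₀^per(v)` is monotone. [folklore] -/
theorem periodicGroundStateEnergy_mono_of_le {N : ℕ} {L : ℝ} {w₁ w₂ : ℝ → ℝ≥0∞}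
    (hw : ∀ r, w₁ r ≤ w₂ r) :
    periodicGroundStateEnergy w₁ N L ≤ periodicGroundStateEnergy w₂ N L :=
  iInf_mono fun Ψ => periodicEnergy_mono_of_le hw Ψ

/-- A potential of range `≤ R` lies below the hard core of radius `2R` (`R > 0`). [folklore] -/
theorem le_hardCorePotential_two_mul {v : ℝ → ℝ≥0∞} {R : ℝ} (hR : 0 < R)
    (hvR : ∀ r, R < r → v r = 0) (r : ℝ) : v r ≤ hardCorePotential (2 * R) r := by
  by_cases hr : r < 2 * R
  · rw [hardCorePotential_of_lt hr]; exact le_top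
  · rw [hvR r (by linarith)]; exact bot_le

/-! ### The uniform kinetic budget -/

/-- The kinetic energy is at most the total energy. [folklore] -/
theorem lintegral_kineticDensity_le_periodicEnergy {N : ℕ} {L : ℝ} (v : ℝ → ℝ≥0∞)
    (Ψ : PeriodicTrialState N L) :
    (∫⁻ X in cellN N L, kineticDensity Ψ.ψ X) ≤ periodicEnergy v Ψ :=
  lintegral_mono fun _ => le_self_add

/-- **Uniform kinetic budget of periodic minimisers** (Dyson–LSSY): for every range bound `R > 0`
there is `ρ₁ > 0` such that for `0 < ρ < ρ₁` and all large `N`, every minimiser of the periodic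
energy of ANY potential vanishing beyond `R`, on the torus of side `(N/ρ)^{1/3}`, has kinetic
energy `≤ 16πRρN`: `T ≤ E₀^per(v) ≤ E₀^per(hard core of radius 2R) ≤ 4πρ₁a(1 + Ca/b)N` with
`a = 2R` by [LSSY2005, Thm. 2.2 (2.14)] and monotonicity of the energy in the potential.
[cite: LSSY2005, Thm. 2.2 (2.14)] -/
theorem kinetic_le_of_minimiser_uniform {R : ℝ} (hR : 0 < R) :
    ∃ ρ₁ : ℝ, 0 < ρ₁ ∧ ∀ ρ : ℝ, 0 < ρ → ρ < ρ₁ → ∀ᶠ N : ℕ in atTop,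
      ∀ v : ℝ → ℝ≥0∞, (∀ r, R < r → v r = 0) →
      ∀ Ψ : PeriodicTrialState N (sideLength ρ N),
        periodicEnergy v Ψ = periodicGroundStateEnergy v N (sideLength ρ N) →
        (∫⁻ X in cellN N (sideLength ρ N), kineticDensity Ψ.ψ X) ≤
          ENNReal.ofReal (16 * Real.pi * R * ρ * N) := by
  set w : ℝ → ℝ≥0∞ := hardCorePotential (2 * R) with hw
  have hwr : ∀ r, 2 * R < r → w r = 0 := fun r hr => hardCorePotential_of_le hr.le
  have haw : scatteringLength w = ENNReal.ofReal (2 * R) := scatteringLength_hardCorePotential _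
  obtain ⟨C, c, hC, hc, H⟩ := LSSY2005_upperBound_periodic_holds w (2 * R)
    (measurable_hardCorePotential _) hwr (by rw [haw]; exact ENNReal.ofReal_ne_top)
  have ha : (scatteringLength w).toReal = 2 * R := by
    rw [haw, ENNReal.toReal_ofReal (by linarith)]
  -- the smallness threshold
  set c' : ℝ := min c (1 / C) with hc'
  have hc'pos : 0 < c' := lt_min hc (by positivity)
  set ρ₁ : ℝ := 3 * (c' / (2 * R)) ^ 3 / (4 * Real.pi) with hρ₁
  have hρ₁pos : 0 < ρ₁ := by positivity
  refine ⟨ρ₁, hρ₁pos, fun ρ hρ hρlt => ?_⟩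
  filter_upwards [eventually_ge_atTop 2, (tendsto_sideLength_atTop hρ).eventually_gt_atTop (2 * (2 * R))]
    with N hN2 hLR v hvR
  have hN0 : 0 < N := by omega
  have hL : 0 < sideLength ρ N := by
    unfold sideLength; exact Real.rpow_pos_of_pos (div_pos (by exact_mod_cast hN0) hρ) _
  have hρL : (N : ℝ) / sideLength ρ N ^ 3 = ρ := div_sideLength_pow_three hρ hN0
  generalize sideLength ρ N = L at hL hρL hLR ⊢
  intro Ψ hmin
  -- the effective density `ρ₁' = (N-1)/L³ ≤ ρ`
  set ρe : ℝ := ((N : ℝ) - 1) / L ^ 3 with hρe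
  have hρe_le : ρe ≤ ρ := by
    rw [hρe, ← hρL]
    exact div_le_div_of_nonneg_right (by linarith) (by positivity)
  have hρe_pos : 0 < ρe := by
    rw [hρe]
    have : (2 : ℝ) ≤ N := by exact_mod_cast hN2
    exact div_pos (by linarith) (by positivity)
  have hx_pos : 0 < 4 * Real.pi * ρe / 3 := by positivity
  -- `a/b = 2R (4πρe/3)^{1/3} ≤ 2R (4πρ/3)^{1/3} < c'`
  have hab_eq : (2 * R) / (4 * Real.pi * ρe / 3) ^ (-(1 : ℝ) / 3) =
      2 * R * (4 * Real.pi * ρe / 3) ^ ((1 : ℝ) / 3) := by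
    rw [show (-(1 : ℝ) / 3) = -(1 / 3) by norm_num, Real.rpow_neg hx_pos.le, div_inv_eq_mul]
  have hab_lt : 2 * R * (4 * Real.pi * ρe / 3) ^ ((1 : ℝ) / 3) < c' := by
    have h1 : (4 * Real.pi * ρe / 3) ^ ((1 : ℝ) / 3) ≤ (4 * Real.pi * ρ / 3) ^ ((1 : ℝ) / 3) :=
      Real.rpow_le_rpow hx_pos.le (by gcongr) (by norm_num)
    have h2 : (4 * Real.pi * ρ / 3) ^ ((1 : ℝ) / 3) < (4 * Real.pi * ρ₁ / 3) ^ ((1 : ℝ) / 3) :=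
      Real.rpow_lt_rpow (by positivity) (by gcongr) (by norm_num)
    have h3 : (4 * Real.pi * ρ₁ / 3) ^ ((1 : ℝ) / 3) = c' / (2 * R) := by
      rw [hρ₁]
      have : 4 * Real.pi * (3 * (c' / (2 * R)) ^ 3 / (4 * Real.pi)) / 3 = (c' / (2 * R)) ^ 3 := by
        field_simp
      rw [this, show ((1 : ℝ) / 3) = ((3 : ℕ) : ℝ)⁻¹ by norm_num,
        Real.pow_rpow_inv_natCast (by positivity) three_ne_zero]
    calc 2 * R * (4 * Real.pi * ρe / 3) ^ ((1 : ℝ) / 3)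
        < 2 * R * (c' / (2 * R)) := by
          apply mul_lt_mul_of_pos_left (h1.trans_lt (h2.trans_eq h3)) (by linarith)
      _ = c' := by field_simp
  have hab_c : (2 * R) / (4 * Real.pi * ρe / 3) ^ (-(1 : ℝ) / 3) ≤ c := by
    rw [hab_eq]; exact (hab_lt.le.trans (min_le_left _ _))
  have hab_C : C * ((2 * R) / (4 * Real.pi * ρe / 3) ^ (-(1 : ℝ) / 3)) ≤ 1 := by
    rw [hab_eq]
    have h1 : 2 * R * (4 * Real.pi * ρe / 3) ^ ((1 : ℝ) / 3) ≤ 1 / C :=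
      hab_lt.le.trans (min_le_right _ _)
    calc C * (2 * R * (4 * Real.pi * ρe / 3) ^ ((1 : ℝ) / 3)) ≤ C * (1 / C) :=
          mul_le_mul_of_nonneg_left h1 hC.le
      _ = 1 := by field_simp
  -- apply Thm. 2.2 to the hard core
  have hU := H N L hN2 hL (by linarith) 
  simp only at hU
  rw [ha] at hU
  have hU' := hU hab_c
  calc (∫⁻ X in cellN N L, kineticDensity Ψ.ψ X) ≤ periodicEnergy v Ψ :=
        lintegral_kineticDensity_le_periodicEnergy v Ψ
    _ = periodicGroundStateEnergy v N L := hmin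
    _ ≤ periodicGroundStateEnergy w N L :=
        periodicGroundStateEnergy_mono_of_le (le_hardCorePotential_two_mul hR hvR)
    _ ≤ ENNReal.ofReal (4 * Real.pi * ρe * (2 * R) *
          (1 + C * ((2 * R) / (4 * Real.pi * ρe / 3) ^ (-(1 : ℝ) / 3))) * N) := hU'
    _ ≤ ENNReal.ofReal (16 * Real.pi * R * ρ * N) := by
        apply ENNReal.ofReal_le_ofReal
        have hN' : (0 : ℝ) ≤ N := N.cast_nonneg
        have h1 : 1 + C * ((2 * R) / (4 * Real.pi * ρe / 3) ^ (-(1 : ℝ) / 3)) ≤ 2 := by linarith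
        have h0 : 0 ≤ 1 + C * ((2 * R) / (4 * Real.pi * ρe / 3) ^ (-(1 : ℝ) / 3)) := by
          rw [hab_eq]; positivity
        calc 4 * Real.pi * ρe * (2 * R) * (1 + C * ((2 * R) / (4 * Real.pi * ρe / 3) ^ (-(1 : ℝ) / 3))) * N
            ≤ 4 * Real.pi * ρ * (2 * R) * 2 * N := by
              gcongr
          _ = 16 * Real.pi * R * ρ * N := by ring

/-! ### The infrared lattice sum `∑_{0 < |m| ≤ M} |m|⁻² ≤ 96 M` on `ℤ³` -/

/-- `‖latticeVec 1 m‖² = ∑ⱼ mⱼ²`. [folklore] -/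
theorem norm_latticeVec_one_sq (m : Fin 3 → ℤ) :
    ‖latticeVec 1 m‖ ^ 2 = ∑ j, ((m j : ℤ) : ℝ) ^ 2 := by
  rw [EuclideanSpace.norm_sq_eq]
  refine Finset.sum_congr rfl fun j _ => ?_
  simp [latticeVec]

/-- A nonzero integer vector has sup norm `≥ 1`. [folklore] -/
theorem one_le_supNorm_of_ne_zero {m : Fin 3 → ℤ} (hm : m ≠ 0) :
    1 ≤ Finset.univ.sup fun j => (m j).natAbs := by
  by_contra h
  push Not at h
  apply hm
  funext j
  have hj := natAbs_le_supNorm m j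
  have : (m j).natAbs = 0 := by omega
  simpa using this

/-- **The infrared lattice sum in `d = 3`**: for a finite set of nonzero integer vectors,
`∑_{m ∈ s, |m| ≤ M} |m|⁻² ≤ 96 M` (shell counting; this is where `d ≥ 3` enters: the sum of
`|m|⁻²` over the ball of radius `M` grows only linearly in `M`). [folklore] -/
theorem sum_inv_norm_sq_latticeVec_le (s : Finset (Fin 3 → ℤ)) (hs : (0 : Fin 3 → ℤ) ∉ s)
    {M : ℝ} (hM : 0 ≤ M) :
    ∑ m ∈ s.filter (fun m => ‖latticeVec 1 m‖ ≤ M), (‖latticeVec 1 m‖ ^ 2)⁻¹ ≤ 96 * M := by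
  set T := s.filter (fun n => 1 ≤ (Finset.univ.sup fun j => (n j).natAbs) ∧
    (Finset.univ.sup fun j => (n j).natAbs) ≤ ⌊M⌋₊) with hT
  have hsub : s.filter (fun m => ‖latticeVec 1 m‖ ≤ M) ⊆ T := by
    intro m hm
    rw [Finset.mem_filter] at hm ⊢
    refine ⟨hm.1, one_le_supNorm_of_ne_zero (fun h => hs (h ▸ hm.1)), ?_⟩
    have h1 : ((((Finset.univ.sup fun j => (m j).natAbs : ℕ)) : ℝ)) ^ 2 ≤ M ^ 2 := by
      calc _ ≤ ∑ j, ((m j : ℤ) : ℝ) ^ 2 := supNorm_sq_le_nsq m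
        _ = ‖latticeVec 1 m‖ ^ 2 := (norm_latticeVec_one_sq m).symm
        _ ≤ M ^ 2 := pow_le_pow_left₀ (norm_nonneg _) hm.2 2
    have h2 : (((Finset.univ.sup fun j => (m j).natAbs : ℕ)) : ℝ) ≤ M := by
      nlinarith [Nat.cast_nonneg (α := ℝ) (Finset.univ.sup fun j => (m j).natAbs)]
    exact Nat.le_floor h2
  have hle : ∀ m ∈ T, (‖latticeVec 1 m‖ ^ 2)⁻¹ ≤
      ((((Finset.univ.sup fun j => (m j).natAbs : ℕ)) : ℝ) ^ 2)⁻¹ := by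
    intro m hm
    rw [Finset.mem_filter] at hm
    have hpos : (0 : ℝ) < (((Finset.univ.sup fun j => (m j).natAbs : ℕ)) : ℝ) ^ 2 := by
      have : (1 : ℝ) ≤ (((Finset.univ.sup fun j => (m j).natAbs : ℕ)) : ℝ) := by
        exact_mod_cast hm.2.1
      positivity
    refine inv_anti₀ hpos ?_
    rw [norm_latticeVec_one_sq]
    exact supNorm_sq_le_nsq m
  calc ∑ m ∈ s.filter (fun m => ‖latticeVec 1 m‖ ≤ M), (‖latticeVec 1 m‖ ^ 2)⁻¹
      ≤ ∑ m ∈ T, (‖latticeVec 1 m‖ ^ 2)⁻¹ :=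
        Finset.sum_le_sum_of_subset_of_nonneg hsub fun m _ _ => by positivity
    _ ≤ ∑ m ∈ T, ((((Finset.univ.sup fun j => (m j).natAbs : ℕ)) : ℝ) ^ 2)⁻¹ :=
        Finset.sum_le_sum hle
    _ ≤ 96 * (⌊M⌋₊ : ℝ) := sum_inv_supNorm_sq_le s ⌊M⌋₊
    _ ≤ 96 * M := by gcongr; exact Nat.floor_le hM

/-- `‖k_m‖² > 0` for `m ≠ 0` (`k_m = 2πm/L`). [folklore] -/
theorem normSq_waveVec_pos' {L : ℝ} (hL : 0 < L) {m : Fin 3 → ℤ} (hm : m ≠ 0) :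
    0 < ‖(2 * Real.pi / L) • latticeVec 1 m‖ ^ 2 := by
  have h1 : 1 ≤ ∑ j, ((m j : ℤ) : ℝ) ^ 2 := by
    have h := one_le_supNorm_of_ne_zero hm
    have h' : (1 : ℝ) ≤ (((Finset.univ.sup fun j => (m j).natAbs : ℕ)) : ℝ) := by exact_mod_cast h
    nlinarith [supNorm_sq_le_nsq m]
  rw [norm_smul, mul_pow, norm_latticeVec_one_sq, Real.norm_of_nonneg (by positivity)]
  have : 0 < (2 * Real.pi / L) ^ 2 := by positivity
  nlinarith

/-- **Weighted infrared sum**: for non-negative weights `w` with `w ≤ A₂` termwise and partial sums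
`≤ B`, `∑_{m ∈ s} w_m |k_m|⁻² ≤ A₂ · 96 κL³/(2π)³ + κ⁻² B` (`k_m = 2πm/L`, `0 ∉ s`), splitting at
`|k_m| = κ`. [folklore] -/
theorem weighted_infrared_sum_le {w : (Fin 3 → ℤ) → ℝ} (hw : ∀ m, 0 ≤ w m) {A₂ B : ℝ}
    (hA₂ : ∀ m, w m ≤ A₂) (hB : ∀ s : Finset (Fin 3 → ℤ), ∑ m ∈ s, w m ≤ B)
    {L κ : ℝ} (hL : 0 < L) (hκ : 0 < κ) (s : Finset (Fin 3 → ℤ)) (hs : (0 : Fin 3 → ℤ) ∉ s) :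
    ∑ m ∈ s, w m * (‖(2 * Real.pi / L) • latticeVec 1 m‖ ^ 2)⁻¹ ≤
      A₂ * (96 * (κ * L ^ 3 / (2 * Real.pi) ^ 3)) + κ⁻¹ ^ 2 * B := by
  have h2πL : 0 < 2 * Real.pi / L := by positivity
  have hnorm : ∀ m : Fin 3 → ℤ, ‖(2 * Real.pi / L) • latticeVec 1 m‖ =
      2 * Real.pi / L * ‖latticeVec 1 m‖ := fun m => by
    rw [norm_smul, Real.norm_of_nonneg h2πL.le]
  rw [← Finset.sum_filter_add_sum_filter_not s (fun m => ‖(2 * Real.pi / L) • latticeVec 1 m‖ ≤ κ)]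
  refine add_le_add ?_ ?_
  · -- the infrared shells `|k_m| ≤ κ`, i.e. `|m| ≤ κL/2π`
    have hfilt : s.filter (fun m => ‖(2 * Real.pi / L) • latticeVec 1 m‖ ≤ κ) =
        s.filter (fun m => ‖latticeVec 1 m‖ ≤ κ * L / (2 * Real.pi)) := by
      refine Finset.filter_congr fun m _ => ?_
      rw [hnorm, le_div_iff₀ (by positivity), div_mul_eq_mul_div, div_le_iff₀ hL]
      constructor <;> intro h <;> nlinarith [h]
    have hA₂0 : 0 ≤ A₂ := (hw 0).trans (hA₂ 0)
    calc ∑ m ∈ s.filter (fun m => ‖(2 * Real.pi / L) • latticeVec 1 m‖ ≤ κ),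
          w m * (‖(2 * Real.pi / L) • latticeVec 1 m‖ ^ 2)⁻¹
        ≤ ∑ m ∈ s.filter (fun m => ‖latticeVec 1 m‖ ≤ κ * L / (2 * Real.pi)),
            A₂ * ((L / (2 * Real.pi)) ^ 2 * (‖latticeVec 1 m‖ ^ 2)⁻¹) := by
          rw [hfilt]
          refine Finset.sum_le_sum fun m _ => ?_
          rw [hnorm, mul_pow, mul_inv, show ((2 * Real.pi / L) ^ 2)⁻¹ = (L / (2 * Real.pi)) ^ 2 by
            rw [← inv_pow, inv_div]]
          exact mul_le_mul_of_nonneg_right (hA₂ m) (by positivity)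
      _ = A₂ * (L / (2 * Real.pi)) ^ 2 *
            ∑ m ∈ s.filter (fun m => ‖latticeVec 1 m‖ ≤ κ * L / (2 * Real.pi)),
              (‖latticeVec 1 m‖ ^ 2)⁻¹ := by
          rw [Finset.mul_sum]
          refine Finset.sum_congr rfl fun m _ => by ring
      _ ≤ A₂ * (L / (2 * Real.pi)) ^ 2 * (96 * (κ * L / (2 * Real.pi))) := by
          gcongr
          exact sum_inv_norm_sq_latticeVec_le s hs (by positivity)
      _ = A₂ * (96 * (κ * L ^ 3 / (2 * Real.pi) ^ 3)) := by ring
  · -- the ultraviolet tail `|k_m| > κ`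
    calc ∑ m ∈ s.filter (fun m => ¬‖(2 * Real.pi / L) • latticeVec 1 m‖ ≤ κ),
          w m * (‖(2 * Real.pi / L) • latticeVec 1 m‖ ^ 2)⁻¹
        ≤ ∑ m ∈ s.filter (fun m => ¬‖(2 * Real.pi / L) • latticeVec 1 m‖ ≤ κ), w m * κ⁻¹ ^ 2 := by
          refine Finset.sum_le_sum fun m hm => ?_
          have hlt : κ < ‖(2 * Real.pi / L) • latticeVec 1 m‖ := lt_of_not_ge (Finset.mem_filter.1 hm).2
          refine mul_le_mul_of_nonneg_left ?_ (hw m)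
          rw [← inv_pow]
          exact pow_le_pow_left₀ (by positivity) ((inv_lt_inv₀ (hκ.trans hlt) hκ).2 hlt).le 2
      _ = κ⁻¹ ^ 2 * ∑ m ∈ s.filter (fun m => ¬‖(2 * Real.pi / L) • latticeVec 1 m‖ ≤ κ), w m := by
          rw [Finset.mul_sum]; refine Finset.sum_congr rfl fun m _ => by ring
      _ ≤ κ⁻¹ ^ 2 * B := mul_le_mul_of_nonneg_left (hB _) (by positivity)

/-! ### Real bookkeeping: the Lévy bound from the floor, and the error budget -/

/-- **Lévy weight bound from a quadratic floor**: `min(½, K/(16C_Fρ)) ≤ S` and `N ν S ≤ C_I` give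
`ν ≤ (C_I/N)(2 + 16C_Fρ/K)`. [folklore] -/
theorem levy_le_of_floor {N C_F C_I ρ K S ν : ℝ} (hN : 0 < N) (hCF : 0 < C_F) (hCI : 0 ≤ C_I)
    (hρ : 0 < ρ) (hK : 0 < K) (hfloor : min (1 / 2 : ℝ) (K / (16 * C_F * ρ)) ≤ S)
    (hI : N * ν * S ≤ C_I) : ν ≤ C_I / N * (2 + 16 * C_F * ρ / K) := by
  have hμ : 0 < min (1 / 2 : ℝ) (K / (16 * C_F * ρ)) := lt_min (by norm_num) (by positivity)
  have hS : 0 < S := hμ.trans_le hfloor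
  rcases le_or_gt ν 0 with hν | hν
  · exact hν.trans (by positivity)
  · -- `ν ≤ C_I/(N S) ≤ C_I/(N μ)` and `1/μ ≤ 2 + 16 C_F ρ / K`
    have h1 : ν ≤ C_I / (N * S) := by
      rw [le_div_iff₀ (by positivity)]; linarith [hI]
    have h2 : C_I / (N * S) ≤ C_I / (N * min (1 / 2 : ℝ) (K / (16 * C_F * ρ))) := by
      apply div_le_div_of_nonneg_left hCI (by positivity)
      exact mul_le_mul_of_nonneg_left hfloor hN.le
    have h3 : C_I / (N * min (1 / 2 : ℝ) (K / (16 * C_F * ρ))) ≤ C_I / N * (2 + 16 * C_F * ρ / K) := by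
      rw [div_mul_eq_div_div]
      rw [div_le_iff₀ hμ, mul_assoc]
      refine le_mul_of_one_le_right (by positivity) ?_
      rcases min_choice (1 / 2 : ℝ) (K / (16 * C_F * ρ)) with h | h <;> rw [h]
      · have : 0 ≤ 16 * C_F * ρ / K := by positivity
        nlinarith
      · have hk : K / (16 * C_F * ρ) * (16 * C_F * ρ / K) = 1 := by field_simp
        have : 0 ≤ K / (16 * C_F * ρ) := by positivity
        nlinarith
    exact h1.trans (h2.trans h3)

/-- **The error budget of the zero mode** (pure bookkeeping): with `A ≥ d₀³/(8L³s³)`, `d₀ ≤ 1`,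
`(C_I/(s²L³))·(2A + 16C_F s²(A²·96·sL³/(2π)³ + s⁻²A)) ≤ A²·s·C_I(16 + 136 C_F)/d₀³`. [folklore] -/
theorem zero_mode_error_budget {C_I C_F d₀ s L A : ℝ} (hCI : 0 ≤ C_I) (hCF : 0 < C_F)
    (hd₀ : 0 < d₀) (hd₀1 : d₀ ≤ 1) (hs : 0 < s) (hL : 0 < L)
    (hA : d₀ ^ 3 / (8 * L ^ 3 * s ^ 3) ≤ A) :
    C_I / (s ^ 2 * L ^ 3) * (2 * A + 16 * C_F * s ^ 2 *
        (A ^ 2 * (96 * (s * L ^ 3 / (2 * Real.pi) ^ 3)) + s⁻¹ ^ 2 * A)) ≤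
      A ^ 2 * (s * (C_I * (16 + 136 * C_F) / d₀ ^ 3)) := by
  have hA0 : 0 < A := lt_of_lt_of_le (by positivity) hA
  have hd3 : d₀ ^ 3 ≤ 1 := pow_le_one₀ hd₀.le hd₀1
  have hπ3 : 192 ≤ (2 * Real.pi) ^ 3 := by
    have h3 : (3 : ℝ) ≤ Real.pi := Real.pi_gt_three.le
    have h6 : (6 : ℝ) ≤ 2 * Real.pi := by linarith
    calc (192 : ℝ) ≤ 6 ^ 3 := by norm_num
      _ ≤ (2 * Real.pi) ^ 3 := pow_le_pow_left₀ (by norm_num) h6 3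
  -- `1/A ≤ 8 L³ s³ / d₀³`
  have hinvA : 1 ≤ A * (8 * L ^ 3 * s ^ 3 / d₀ ^ 3) := by
    rw [div_le_iff₀ (by positivity)] at hA
    rw [mul_div_assoc', le_div_iff₀ (by positivity), one_mul]
    linarith
  -- term 1
  have T1 : C_I / (s ^ 2 * L ^ 3) * (2 * A) ≤ A ^ 2 * (s * (C_I * 16 / d₀ ^ 3)) := by
    have : C_I / (s ^ 2 * L ^ 3) * (2 * A) * 1 ≤
        C_I / (s ^ 2 * L ^ 3) * (2 * A) * (A * (8 * L ^ 3 * s ^ 3 / d₀ ^ 3)) :=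
      mul_le_mul_of_nonneg_left hinvA (by positivity)
    calc C_I / (s ^ 2 * L ^ 3) * (2 * A) = C_I / (s ^ 2 * L ^ 3) * (2 * A) * 1 := by ring
      _ ≤ C_I / (s ^ 2 * L ^ 3) * (2 * A) * (A * (8 * L ^ 3 * s ^ 3 / d₀ ^ 3)) := this
      _ = A ^ 2 * (s * (C_I * 16 / d₀ ^ 3)) := by field_simp; ring
  -- term 2
  have T2 : C_I / (s ^ 2 * L ^ 3) * (16 * C_F * s ^ 2 * (A ^ 2 * (96 * (s * L ^ 3 / (2 * Real.pi) ^ 3)))) ≤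
      A ^ 2 * (s * (C_I * (8 * C_F) / d₀ ^ 3)) := by
    have h1 : C_I / (s ^ 2 * L ^ 3) * (16 * C_F * s ^ 2 * (A ^ 2 * (96 * (s * L ^ 3 / (2 * Real.pi) ^ 3)))) =
        A ^ 2 * (s * (C_I * C_F)) * (1536 / (2 * Real.pi) ^ 3) := by
      field_simp
      ring
    have h2 : (1536 : ℝ) / (2 * Real.pi) ^ 3 ≤ 8 := by
      rw [div_le_iff₀ (by positivity)]; linarith
    have h3 : (8 : ℝ) ≤ 8 / d₀ ^ 3 := by
      rw [le_div_iff₀ (by positivity)]; nlinarith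
    calc _ = A ^ 2 * (s * (C_I * C_F)) * (1536 / (2 * Real.pi) ^ 3) := h1
      _ ≤ A ^ 2 * (s * (C_I * C_F)) * (8 / d₀ ^ 3) :=
          mul_le_mul_of_nonneg_left (h2.trans h3) (by positivity)
      _ = A ^ 2 * (s * (C_I * (8 * C_F) / d₀ ^ 3)) := by ring
  -- term 3
  have T3 : C_I / (s ^ 2 * L ^ 3) * (16 * C_F * s ^ 2 * (s⁻¹ ^ 2 * A)) ≤
      A ^ 2 * (s * (C_I * (128 * C_F) / d₀ ^ 3)) := by
    have : C_I / (s ^ 2 * L ^ 3) * (16 * C_F * s ^ 2 * (s⁻¹ ^ 2 * A)) * 1 ≤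
        C_I / (s ^ 2 * L ^ 3) * (16 * C_F * s ^ 2 * (s⁻¹ ^ 2 * A)) * (A * (8 * L ^ 3 * s ^ 3 / d₀ ^ 3)) :=
      mul_le_mul_of_nonneg_left hinvA (by positivity)
    calc C_I / (s ^ 2 * L ^ 3) * (16 * C_F * s ^ 2 * (s⁻¹ ^ 2 * A))
        = C_I / (s ^ 2 * L ^ 3) * (16 * C_F * s ^ 2 * (s⁻¹ ^ 2 * A)) * 1 := by ring
      _ ≤ _ := this
      _ = A ^ 2 * (s * (C_I * (128 * C_F) / d₀ ^ 3)) := by field_simp; ring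
  calc C_I / (s ^ 2 * L ^ 3) * (2 * A + 16 * C_F * s ^ 2 *
        (A ^ 2 * (96 * (s * L ^ 3 / (2 * Real.pi) ^ 3)) + s⁻¹ ^ 2 * A))
      = C_I / (s ^ 2 * L ^ 3) * (2 * A) +
        C_I / (s ^ 2 * L ^ 3) * (16 * C_F * s ^ 2 * (A ^ 2 * (96 * (s * L ^ 3 / (2 * Real.pi) ^ 3)))) +
        C_I / (s ^ 2 * L ^ 3) * (16 * C_F * s ^ 2 * (s⁻¹ ^ 2 * A)) := by ring
    _ ≤ A ^ 2 * (s * (C_I * 16 / d₀ ^ 3)) + A ^ 2 * (s * (C_I * (8 * C_F) / d₀ ^ 3)) +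
        A ^ 2 * (s * (C_I * (128 * C_F) / d₀ ^ 3)) := add_le_add (add_le_add T1 T2) T3
    _ = A ^ 2 * (s * (C_I * (16 + 136 * C_F) / d₀ ^ 3)) := by ring

end Literature.MathematicalPhysics.QuantumManyBody.BoseGas

end
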